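import Literature.Analysis.FunctionSpaces.PlancherelL1L2
import Mathlib.MeasureTheory.Measure.Lebesgue.Integral
import Mathlib.MeasureTheory.Integral.IntervalIntegral.Basic

/-!
# Radiation profiles of one-sided spectra: Plancherel bookkeeping and the half-energy identity

Topic `Literature/Analysis/Fourier`.  For a spectral density `g ∈ L¹(ℝ) ∩ L²(ℝ)` put
`Z(u) = ∫ g(ω) e^{-iωu} dω` (the "radiation profile" normalisation used for the Fourier-side forms of windowed /
exterior wave energies: `E = ∫ ‖Z‖²`, `A(u₀) = ∫_{u<u₀} ‖Z‖²`, `B(u₀) = Re ∫_{u<u₀} Z²`).  This file proves the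
elementary identities behind the odd-dimensional exterior-energy ("channel of energy") identity of
Duyckaerts–Kenig–Merle in this Fourier form:

* `integral_mul_cexp_neg_eq_fourier` — `Z(u) = 𝓕 g (u / 2π)` (Mathlib's Fourier integral);
* `integral_norm_sq_integral_mul_cexp_neg` — **Plancherel**: `∫ ‖Z‖² = 2π ∫ ‖g‖²` (from
  `Literature.Analysis.FunctionSpaces.integral_norm_sq_fourierIntegral_eq`, Titchmarsh Thm. 48);
* `integral_sq_integral_mul_cexp_neg_eq_zero` — **one-sided spectrum**: if `g` vanishes off `(0, ∞)` then
  `∫ Z² = 0` (polarisation of Plancherel against the conjugate-reflected density `ω ↦ conj g(-ω)`, whose profile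
  is `conj Z` and which is pointwise orthogonal to `g`);
* `integral_ofReal_mul_cexp_neg_neg` — for a REAL density `Z(-u) = conj Z(u)`, whence
  `setIntegral_Iic_norm_sq_integral_ofReal_mul_cexp_neg` (`∫_{u≤0} ‖Z‖² = π ∫ c²`, half of the energy) and
  `re_setIntegral_Iic_sq_integral_ofReal_mul_cexp_neg` (`Re ∫_{u≤0} Z² = 0`);
* `benignConstantPhase_identity` — the two facts for the profile with a constant benign phase `e^{imπ/2}`, in
  the exact shape of `BenignConstantPhaseIdentity` of the crux sketch
  `Summits/FinalStateConjecture/FinalStateConjecture/Cruxes/WindowedShellChannels/SketchCoulombPhase.lean`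
  (the `a → 0` anchor of the conjectural Coulomb-phase channel lemma of line `coulomb-phase`,
  stmt-FinalStateConjecture-14085): the caught fraction at the apex is exactly `½` for both parities.

References: T. Duyckaerts, C. Kenig, F. Merle, *Classification of radial solutions of the focusing, energy-critical
wave equation*, Camb. J. Math. 1 (2013), 75–144 (exterior energy for odd dimensions); E. C. Titchmarsh,
*Introduction to the Theory of Fourier Integrals*, Thm. 48.  All statements are folklore; no definitions.
-/

noncomputable section

namespace Literature.Analysis.Fourier

open _root_.MeasureTheory Set Filter _root_.Complex
open scoped FourierTransform Real Topology ComplexConjugate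

/-- The transform `u ↦ ∫ g(ω) e^{-iωu} dω` is Mathlib's Fourier integral evaluated at `u / (2π)`. [folklore] -/
theorem integral_mul_cexp_neg_eq_fourier (g : ℝ → ℂ) (u : ℝ) :
    ∫ ω, g ω * cexp (-(I * ω * u)) = 𝓕 g (u / (2 * π)) := by
  rw [Real.fourier_real_eq_integral_exp_smul]
  refine integral_congr_ae (ae_of_all _ fun ω => ?_)
  simp only [smul_eq_mul]
  rw [mul_comm (g ω)]
  congr 1
  congr 1
  have hπ : (π : ℂ) ≠ 0 := ofReal_ne_zero.mpr Real.pi_ne_zero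
  push_cast
  field_simp

/-- **Plancherel in the `e^{-iωu}` normalisation**: `∫ ‖∫ g(ω) e^{-iωu} dω‖² du = 2π ∫ ‖g‖²` for
`g ∈ L¹(ℝ) ∩ L²(ℝ)`. [folklore] -/
theorem integral_norm_sq_integral_mul_cexp_neg {g : ℝ → ℂ} (h1 : Integrable g) (h2 : MemLp g 2) :
    ∫ u : ℝ, ‖∫ ω, g ω * cexp (-(I * ω * u))‖ ^ 2 = 2 * π * ∫ ω, ‖g ω‖ ^ 2 := by
  have e : ∀ u : ℝ, ‖∫ ω, g ω * cexp (-(I * ω * u))‖ ^ 2 = ‖𝓕 g ((2 * π)⁻¹ * u)‖ ^ 2 :=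
    fun u => by rw [integral_mul_cexp_neg_eq_fourier, div_eq_inv_mul]
  have h := Literature.Analysis.FunctionSpaces.integral_norm_sq_fourierIntegral_eq h1 h2
  simp_rw [e]
  rw [Measure.integral_comp_mul_left (fun ξ => ‖𝓕 g ξ‖ ^ 2) ((2 * π)⁻¹), inv_inv, h, smul_eq_mul,
    abs_of_pos (by positivity)]

/-- Conjugate reflection of the density conjugates the transform:
`∫ conj(g(-ω)) e^{-iωu} dω = conj (∫ g(ω) e^{-iωu} dω)`. [folklore] -/
theorem integral_conj_neg_mul_cexp_neg (g : ℝ → ℂ) (u : ℝ) :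
    ∫ ω, conj (g (-ω)) * cexp (-(I * ω * u)) = conj (∫ ω, g ω * cexp (-(I * ω * u))) := by
  rw [← integral_conj]
  rw [← integral_neg_eq_self (fun ω : ℝ => conj (g (-ω)) * cexp (-(I * ω * u)))]
  refine integral_congr_ae (ae_of_all _ fun ω => ?_)
  simp only [neg_neg, map_mul, ← Complex.exp_conj, map_neg, Complex.conj_I, Complex.conj_ofReal,
    ofReal_neg]
  ring_nf

/-- For a REAL density the transform is conjugate-symmetric: `Z(-u) = conj (Z u)`. [folklore] -/
theorem integral_ofReal_mul_cexp_neg_neg (c : ℝ → ℝ) (u : ℝ) :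
    ∫ ω, (c ω : ℂ) * cexp (-(I * ω * ↑(-u))) = conj (∫ ω, (c ω : ℂ) * cexp (-(I * ω * u))) := by
  rw [← integral_conj]
  refine integral_congr_ae (ae_of_all _ fun ω => ?_)
  simp only [map_mul, ← Complex.exp_conj, map_neg, Complex.conj_I, Complex.conj_ofReal, ofReal_neg]
  ring_nf

/-- The transform integrand is integrable for `g ∈ L¹`. [folklore] -/
theorem integrable_mul_cexp_neg {g : ℝ → ℂ} (h1 : Integrable g) (u : ℝ) :
    Integrable (fun ω : ℝ => g ω * cexp (-(I * ω * u))) := by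
  refine h1.mul_bdd (c := 1) ?_ (ae_of_all _ fun ω => ?_)
  · exact (Complex.continuous_exp.comp (by fun_prop)).aestronglyMeasurable
  · rw [Complex.norm_exp]
    simp only [neg_re, mul_re, I_re, ofReal_re, zero_mul, I_im, ofReal_im, mul_zero, sub_self,
      mul_im, neg_zero, Real.exp_zero, le_refl]

/-- The transform `u ↦ ∫ g(ω) e^{-iωu} dω` of `g ∈ L¹` is continuous. [folklore] -/
theorem continuous_integral_mul_cexp_neg {g : ℝ → ℂ} (h1 : Integrable g) :
    Continuous fun u : ℝ => ∫ ω, g ω * cexp (-(I * ω * u)) := by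
  have e : (fun u : ℝ => ∫ ω, g ω * cexp (-(I * ω * u))) = fun u => 𝓕 g (u / (2 * π)) :=
    funext fun u => integral_mul_cexp_neg_eq_fourier g u
  rw [e]
  exact (Literature.Analysis.FunctionSpaces.continuous_fourierIntegral h1).comp (by fun_prop)

/-- The transform of `g ∈ L¹ ∩ L²` is square integrable: `u ↦ ‖Z u‖²` is integrable. [folklore] -/
theorem integrable_norm_sq_integral_mul_cexp_neg {g : ℝ → ℂ} (h1 : Integrable g) (h2 : MemLp g 2) :
    Integrable fun u : ℝ => ‖∫ ω, g ω * cexp (-(I * ω * u))‖ ^ 2 := by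
  have e : ∀ u : ℝ, ‖∫ ω, g ω * cexp (-(I * ω * u))‖ ^ 2 = ‖𝓕 g ((2 * π)⁻¹ * u)‖ ^ 2 :=
    fun u => by rw [integral_mul_cexp_neg_eq_fourier, div_eq_inv_mul]
  simp_rw [e]
  have hF := Literature.Analysis.FunctionSpaces.memLp_two_fourierIntegral h1 h2
  have i1 : Integrable (fun ξ ↦ ‖𝓕 g ξ‖ ^ 2) (volume : Measure ℝ) :=
    (memLp_two_iff_integrable_sq_norm hF.1).1 hF
  exact i1.comp_mul_left' (by positivity)

/-- … hence `u ↦ (Z u)²` is integrable. [folklore] -/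
theorem integrable_sq_integral_mul_cexp_neg {g : ℝ → ℂ} (h1 : Integrable g) (h2 : MemLp g 2) :
    Integrable fun u : ℝ => (∫ ω, g ω * cexp (-(I * ω * u))) ^ 2 := by
  refine (integrable_norm_sq_integral_mul_cexp_neg h1 h2).mono' ?_ (ae_of_all _ fun u => ?_)
  · exact ((continuous_integral_mul_cexp_neg h1).pow 2).aestronglyMeasurable
  · rw [norm_pow]

/-- **One-sided spectrum ⇒ `∫ Z² = 0`**: if `g ∈ L¹ ∩ L²` vanishes off `(0, ∞)`, then
`∫ (∫ g(ω) e^{-iωu} dω)² du = 0` (the transform and its square have disjoint-from-reflection spectrum;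
proof by polarisation of Plancherel with the conjugate-reflected density). [folklore] -/
theorem integral_sq_integral_mul_cexp_neg_eq_zero {g : ℝ → ℂ} (h1 : Integrable g) (h2 : MemLp g 2)
    (hsupp : Function.support g ⊆ Ioi 0) :
    ∫ u : ℝ, (∫ ω, g ω * cexp (-(I * ω * u))) ^ 2 = 0 := by
  -- notation
  set Z : ℝ → ℂ := fun u => ∫ ω, g ω * cexp (-(I * ω * u)) with hZ
  set gr : ℝ → ℂ := fun ω => conj (g (-ω)) with hgr
  -- the reflected density: integrable, L², transform = conj Z
  have hgr1 : Integrable gr := by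
    have := (h1.comp_neg)
    refine this.congr' ?_ (ae_of_all _ fun ω => ?_)
    · exact (Complex.continuous_conj.comp_aestronglyMeasurable this.aestronglyMeasurable)
    · simp [hgr]
  have hgr2 : MemLp gr 2 := by
    have := h2.comp_measurePreserving (Measure.measurePreserving_neg (volume : Measure ℝ))
    refine this.congr_norm hgr1.aestronglyMeasurable (ae_of_all _ fun ω => ?_)
    simp [hgr, Function.comp]
  have hZr : ∀ u : ℝ, ∫ ω, gr ω * cexp (-(I * ω * u)) = conj (Z u) := fun u =>
    integral_conj_neg_mul_cexp_neg g u
  -- pointwise orthogonality of g and gr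
  have horth : ∀ ω : ℝ, g ω * g (-ω) = 0 := by
    intro ω
    rcases le_or_gt ω 0 with hω | hω
    · have : g ω = 0 := by
        by_contra hne
        exact absurd (hsupp (Function.mem_support.mpr hne)) (not_lt.mpr hω)
      simp [this]
    · have : g (-ω) = 0 := by
        by_contra hne
        have := hsupp (Function.mem_support.mpr hne)
        simp only [mem_Ioi, Left.neg_pos_iff] at this
        exact absurd this (not_lt.mpr hω.le)
      simp [this]
  -- integrability of the transform pieces
  have hZc : Continuous Z := continuous_integral_mul_cexp_neg h1
  have hZ2 : Integrable fun u : ℝ => ‖Z u‖ ^ 2 := integrable_norm_sq_integral_mul_cexp_neg h1 h2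
  have hZsq : Integrable fun u : ℝ => Z u ^ 2 := integrable_sq_integral_mul_cexp_neg h1 h2
  set S : ℂ := ∫ u : ℝ, Z u ^ 2 with hS
  -- Plancherel for g and for the polarised densities d e := g + e • gr, ‖e‖ = 1
  have hPg : ∫ u : ℝ, ‖Z u‖ ^ 2 = 2 * π * ∫ ω, ‖g ω‖ ^ 2 := integral_norm_sq_integral_mul_cexp_neg h1 h2
  have hgr_norm : ∫ ω, ‖gr ω‖ ^ 2 = ∫ ω, ‖g ω‖ ^ 2 := by
    have : (fun ω => ‖gr ω‖ ^ 2) = fun ω => ‖g (-ω)‖ ^ 2 := funext fun ω => by simp [hgr]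
    rw [this, integral_neg_eq_self (fun ω : ℝ => ‖g ω‖ ^ 2)]
  have key : ∀ e : ℂ, ‖e‖ = 1 → (starRingEnd ℂ e * S).re = 0 := by
    intro e he
    set d : ℝ → ℂ := fun ω => g ω + e * gr ω with hd
    have hd1 : Integrable d := h1.add (hgr1.const_mul e)
    have hd2 : MemLp d 2 := h2.add (hgr2.const_mul e)
    -- pointwise: ‖d‖² = ‖g‖² + ‖gr‖²
    have hdn : ∀ ω, ‖d ω‖ ^ 2 = ‖g ω‖ ^ 2 + ‖gr ω‖ ^ 2 := by
      intro ω
      have h0 : g ω * g (-ω) = 0 := horth ω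
      simp only [hd, hgr, ← Complex.normSq_eq_norm_sq, Complex.normSq_add]
      have : g ω * (starRingEnd ℂ) (e * (starRingEnd ℂ) (g (-ω))) = starRingEnd ℂ e * (g ω * g (-ω)) := by
        simp only [map_mul, Complex.conj_conj]; ring
      rw [this, h0, mul_zero, Complex.zero_re, mul_zero, add_zero, Complex.normSq_mul]
      simp [Complex.normSq_eq_norm_sq, he]
    -- pointwise: the transform of d is Z + e conj Z
    have hZd : ∀ u : ℝ, ∫ ω, d ω * cexp (-(I * ω * u)) = Z u + e * conj (Z u) := by
      intro u
      have i1 := integrable_mul_cexp_neg h1 u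
      have i2 := (integrable_mul_cexp_neg hgr1 u).const_mul e
      have hsplit : (fun ω : ℝ => d ω * cexp (-(I * ω * u))) =
          fun ω => g ω * cexp (-(I * ω * u)) + e * (gr ω * cexp (-(I * ω * u))) := by
        funext ω; simp only [hd]; ring
      rw [hsplit, integral_add i1 i2, integral_const_mul, hZr u]
    -- pointwise: ‖Z + e conj Z‖² = 2‖Z‖² + 2 Re(conj e · Z²)
    have hZdn : ∀ u : ℝ, ‖Z u + e * conj (Z u)‖ ^ 2 = 2 * ‖Z u‖ ^ 2 + 2 * (starRingEnd ℂ e * Z u ^ 2).re := by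
      intro u
      simp only [← Complex.normSq_eq_norm_sq, Complex.normSq_add, map_mul, Complex.conj_conj,
        Complex.normSq_conj]
      have : Complex.normSq e = 1 := by rw [Complex.normSq_eq_norm_sq, he, one_pow]
      rw [this, one_mul]
      have h3 : Z u * ((starRingEnd ℂ) e * Z u) = (starRingEnd ℂ) e * Z u ^ 2 := by ring
      rw [h3]; ring
    -- integrate: Plancherel for d
    have hPd : ∫ u : ℝ, ‖∫ ω, d ω * cexp (-(I * ω * u))‖ ^ 2 = 2 * π * ∫ ω, ‖d ω‖ ^ 2 :=
      integral_norm_sq_integral_mul_cexp_neg hd1 hd2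
    simp_rw [hZd, hZdn, hdn] at hPd
    rw [integral_add, integral_const_mul, integral_const_mul, integral_add, hgr_norm, hPg] at hPd
    · -- hPd : 2 * (2π ∫‖g‖²) + 2 * ∫ Re(conj e Z²) = 2π (∫‖g‖² + ∫‖g‖²)
      have hre : ∫ u : ℝ, (starRingEnd ℂ e * Z u ^ 2).re = (starRingEnd ℂ e * S).re := by
        have hh := integral_re (hZsq.const_mul (starRingEnd ℂ e))
        simp only [RCLike.re_to_complex] at hh
        rw [hh, integral_const_mul]
      rw [hre] at hPd
      linarith
    · exact (memLp_two_iff_integrable_sq_norm h2.1).1 h2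
    · exact (memLp_two_iff_integrable_sq_norm hgr2.1).1 hgr2
    · exact hZ2.const_mul 2
    · refine (Integrable.const_mul ?_ 2)
      exact (hZsq.const_mul _).re
  -- conclude with e = 1 and e = I
  have h1' := key 1 (by simp)
  have hI := key I (by simp)
  simp only [map_one, one_mul] at h1'
  have hIm : S.im = 0 := by
    simp only [Complex.conj_I, neg_mul, Complex.neg_re, Complex.mul_re, Complex.I_re, zero_mul, Complex.I_im,
      one_mul, zero_sub, neg_neg] at hI
    exact hI
  exact Complex.ext h1' hIm

/-! ## Half-line forms for REAL densities: the Duyckaerts–Kenig–Merle anchor -/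

/-- **Half of the energy radiates before `u = 0`** (real density): for `c` real with `(c : ℂ) ∈ L¹ ∩ L²`,
`∫_{u ≤ 0} ‖∫ c(ω) e^{-iωu} dω‖² du = π ∫ c²` — the profile modulus is even in `u`. [folklore] -/
theorem setIntegral_Iic_norm_sq_integral_ofReal_mul_cexp_neg {c : ℝ → ℝ}
    (h1 : Integrable fun ω => (c ω : ℂ)) (h2 : MemLp (fun ω => (c ω : ℂ)) 2) :
    ∫ u in Iic (0 : ℝ), ‖∫ ω, (c ω : ℂ) * cexp (-(I * ω * u))‖ ^ 2 = π * ∫ ω, c ω ^ 2 := by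
  set F : ℝ → ℝ := fun u => ‖∫ ω, (c ω : ℂ) * cexp (-(I * ω * u))‖ ^ 2 with hF
  have hFi : Integrable F := integrable_norm_sq_integral_mul_cexp_neg h1 h2
  have heven : ∀ u, F (-u) = F u := fun u => by
    simp only [hF, integral_ofReal_mul_cexp_neg_neg c u, norm_conj]
  have h1' : ∫ u in Iic (0 : ℝ), F u = ∫ u in Ioi (0 : ℝ), F u := by
    have hh := integral_comp_neg_Iic 0 F
    simp only [heven, neg_zero] at hh
    exact hh
  have hsum := intervalIntegral.integral_Iic_add_Ioi (b := (0 : ℝ)) hFi.integrableOn hFi.integrableOn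
  have htot : ∫ u, F u = 2 * π * ∫ ω, c ω ^ 2 := by
    rw [hF, integral_norm_sq_integral_mul_cexp_neg h1 h2]
    congr 1
    refine integral_congr_ae (ae_of_all _ fun ω => ?_)
    simp only [Complex.norm_real, Real.norm_eq_abs, sq_abs]
  change ∫ u in Iic (0 : ℝ), F u = π * ∫ ω, c ω ^ 2
  linarith

/-- **The Hilbert-type form vanishes at the apex** (real density, one-sided spectrum): for `c` real,
`(c : ℂ) ∈ L¹ ∩ L²`, supported in `(0, ∞)`: `Re ∫_{u ≤ 0} (∫ c(ω) e^{-iωu} dω)² du = 0`. [folklore] -/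
theorem re_setIntegral_Iic_sq_integral_ofReal_mul_cexp_neg {c : ℝ → ℝ}
    (h1 : Integrable fun ω => (c ω : ℂ)) (h2 : MemLp (fun ω => (c ω : ℂ)) 2)
    (hsupp : Function.support c ⊆ Ioi 0) :
    (∫ u in Iic (0 : ℝ), (∫ ω, (c ω : ℂ) * cexp (-(I * ω * u))) ^ 2).re = 0 := by
  set G : ℝ → ℂ := fun u => (∫ ω, (c ω : ℂ) * cexp (-(I * ω * u))) ^ 2 with hG
  have hsupp' : Function.support (fun ω => (c ω : ℂ)) ⊆ Ioi 0 := by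
    intro ω hω
    exact hsupp (by simpa [Function.mem_support] using hω)
  have hGi : Integrable G := integrable_sq_integral_mul_cexp_neg h1 h2
  have hG0 : ∫ u, G u = 0 := integral_sq_integral_mul_cexp_neg_eq_zero h1 h2 hsupp'
  have hrefl : ∀ u, G (-u) = conj (G u) := fun u => by
    simp only [hG, integral_ofReal_mul_cexp_neg_neg c u, map_pow]
  have h1' : ∫ u in Ioi (0 : ℝ), G u = conj (∫ u in Iic (0 : ℝ), G u) := by
    have hh := integral_comp_neg_Iic 0 G
    simp only [hrefl, neg_zero] at hh
    rw [integral_conj] at hh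
    exact hh.symm
  have hsum := intervalIntegral.integral_Iic_add_Ioi (b := (0 : ℝ)) hGi.integrableOn hGi.integrableOn
  rw [hG0, h1'] at hsum
  have := congrArg Complex.re hsum
  simp only [Complex.add_re, Complex.conj_re, Complex.zero_re] at this
  change (∫ u in Iic (0 : ℝ), G u).re = 0
  linarith

/-- **The benign-constant-phase anchor (Duyckaerts–Kenig–Merle half-energy identity, Fourier form)**, in the
exact shape of `BenignConstantPhaseIdentity` of the crux sketch `Cruxes/WindowedShellChannels/SketchCoulombPhase.lean`
(stmt-FinalStateConjecture-14085, line `coulomb-phase`): for a CONSTANT benign phase `mπ/2` and a real continuous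
compactly supported spectral density on `(0, ∞)`, the radiation profile `Z(u) = ∫ c(ω) e^{i(mπ/2 − ωu)} dω` has
`∫_{u ≤ 0} ‖Z‖² = π ∫ c²` (`= E/2`, `E = 2π ∫ c² = ∫ ‖Z‖²`) and `Re ∫_{u ≤ 0} Z² = 0`: the caught fraction at the
apex is exactly one half for both parities. [cite: DuyckaertsKenigMerle2013, odd-dimensional exterior-energy identity;
folklore in this Fourier form] -/
theorem benignConstantPhase_identity :
    ∀ (m : ℤ) (c : ℝ → ℝ), Continuous c → HasCompactSupport c → Function.support c ⊆ Ioi 0 →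
      let Z : ℝ → ℂ := fun u => ∫ ω, (c ω : ℂ) * Complex.exp (Complex.I * ((m * Real.pi / 2 : ℝ) - (ω : ℂ) * (u : ℂ)))
      (∫ u in Iic (0 : ℝ), ‖Z u‖ ^ 2) = Real.pi * ∫ ω, c ω ^ 2 ∧ (∫ u in Iic (0 : ℝ), Z u ^ 2).re = 0 := by
  intro m c hc hcs hsupp Z
  -- the complexified density is continuous with compact support, hence in L¹ ∩ L²
  have hcc : Continuous fun ω => (c ω : ℂ) := Complex.continuous_ofReal.comp hc
  have hccs : HasCompactSupport fun ω => (c ω : ℂ) := hcs.comp_left Complex.ofReal_zero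
  have h1 : Integrable fun ω => (c ω : ℂ) := hcc.integrable_of_hasCompactSupport hccs
  have h2 : MemLp (fun ω => (c ω : ℂ)) 2 := hcc.memLp_of_hasCompactSupport hccs
  -- factor the constant phase out of the profile
  set w : ℂ := Complex.exp (Complex.I * (m * Real.pi / 2 : ℝ)) with hw
  have hZ : ∀ u : ℝ, Z u = w * ∫ ω, (c ω : ℂ) * cexp (-(I * ω * u)) := by
    intro u
    simp only [Z, ← integral_const_mul]
    refine integral_congr_ae (ae_of_all _ fun ω => ?_)
    dsimp only
    rw [mul_sub, sub_eq_add_neg, Complex.exp_add, hw, show I * ((ω : ℂ) * (u : ℂ)) = I * ω * u by ring]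
    ring
  have hwn : ‖w‖ = 1 := by
    rw [hw, mul_comm, Complex.norm_exp_ofReal_mul_I]
  have hw2' : w ^ 2 = Complex.exp (((m : ℝ) * Real.pi : ℝ) * I) := by
    rw [hw, ← Complex.exp_nat_mul]
    congr 1
    push_cast
    ring
  have hw2 : (w ^ 2).im = 0 := by
    rw [hw2', Complex.exp_ofReal_mul_I_im]
    exact_mod_cast Real.sin_int_mul_pi m
  refine ⟨?_, ?_⟩
  · simp_rw [hZ, norm_mul, mul_pow, hwn, one_pow, one_mul]
    exact setIntegral_Iic_norm_sq_integral_ofReal_mul_cexp_neg h1 h2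
  · simp_rw [hZ, mul_pow]
    rw [integral_const_mul, Complex.mul_re, re_setIntegral_Iic_sq_integral_ofReal_mul_cexp_neg h1 h2 hsupp, hw2]
    ring

end Literature.Analysis.Fourier

end
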